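import Literature.AlgebraicGeometry.Resolution.SurfaceResolutionReduction
import Literature.AlgebraicGeometry.Resolution.NormalizationOfVarieties
import Literature.AlgebraicGeometry.Resolution.NormalCrossingsStrictification
import HarnessLib

/-!
# The normalization as a proper birational normal model (normalization bookkeeping)

Support file for crux stmt-ResolutionOfSingularities-15315
(`FrobeniusLadder.FInjectiveMacaulayfication`, line `Sketch`, seat c5): stub
`stub_normalizationModel` of package B (Kawasaki's Macaulayfication is a theorem in dimension
`≤ 2`: the Macaulayfication of an integral surface is its normalization).

For an integral scheme `X` separated and of finite type over a field `k`, the normalization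
`π₁ = normalizationι X : X^ν → X` (`Literature/AlgebraicGeometry/Resolution/NormalizationOfVarieties.lean`)
is a proper birational model with integral source of the same dimension, all of whose local
rings are integrally closed Noetherian domains of dimension `≤ dim X`:

* proper: `X^ν → X` is finite (E. Noether's finiteness of the integral closure,
  `isFinite_normalizationι X NoetherFiniteIntegralClosure_holds f`, Liu 2002, Cor. 4.1.30), and
  finite morphisms are proper (Mathlib);
* birational: `isBirational_normalizationι` (`SurfaceResolutionReduction.lean`);
* integral: Mathlib's instance for the relative normalization in `Spec K(X)`;
* `dim X^ν = dim X`: `topologicalKrullDim_normalization`;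
* stalks integrally closed: `isIntegrallyClosed_stalk_normalization`
  (`AlterationsNormalizationReduction.lean`);
* stalks Noetherian: `X^ν` is locally of finite type over `Spec k` via `X^ν → X → Spec k`, hence
  locally Noetherian (`LocallyOfFiniteType.isLocallyNoetherian`), and stalks of locally
  Noetherian schemes are Noetherian (Mathlib);
* `dim 𝒪_{X^ν, x} ≤ dim X`: `dim 𝒪_{X^ν, x} ≤ dim X^ν`
  (`ringKrullDim_stalk_le_topologicalKrullDim`, `NormalCrossingsStrictification.lean`) and the
  dimension equality.

References: Q. Liu, *Algebraic Geometry and Arithmetic Curves* (2002), Def. 4.1.24, Cor. 4.1.30;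
U. Görtz, T. Wedhorn, *Algebraic Geometry I*, 2nd ed. (2020), Lemma 5.7 (4).
-/

-- single-problem summit: the doubled namespace component is forced
set_option linter.dupNamespace false

noncomputable section

namespace Summit.ResolutionOfSingularities.ResolutionOfSingularities.Theorems.FInjectiveMacaulayfication.NormalizationModel

open AlgebraicGeometry CategoryTheory Literature.AlgebraicGeometry.Resolution

/-- B2 NORMALIZATION BOOKKEEPING: an integral separated finite-type `X/k` has a proper birational
model `X₁ → X` with `X₁` integral of the same dimension, all of whose local rings are integrally
closed Noetherian domains of dimension `≤ dim X` — the normalization `normalizationι X` (finite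
by E. Noether `isFinite_normalizationι … NoetherFiniteIntegralClosure_holds`, hence proper;
birational `isBirational_normalizationι`; `topologicalKrullDim_normalization`;
`isIntegrallyClosed_stalk_normalization`; stalks of a scheme locally of finite type over a field
are Noetherian of dimension `≤ dim`). [cite: Liu2002, Cor. 4.1.30] -/
theorem stub_normalizationModel : ∀ (k : Type) [Field k] (X : Scheme.{0}) (f : X ⟶ Spec (.of k)),
    IsSeparated f → LocallyOfFiniteType f → QuasiCompact f → IsIntegral X →
      ∃ (X₁ : Scheme.{0}) (π₁ : X₁ ⟶ X), IsProper π₁ ∧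
        Literature.AlgebraicGeometry.Resolution.IsBirational π₁ ∧ IsIntegral X₁ ∧
        topologicalKrullDim X₁ = topologicalKrullDim X ∧
        ∀ x : X₁, IsIntegrallyClosed (X₁.presheaf.stalk x) ∧ IsNoetherianRing (X₁.presheaf.stalk x) ∧
          ringKrullDim (X₁.presheaf.stalk x) ≤ topologicalKrullDim X := by
  intro k _ X f _ hft _ hint
  haveI := hft
  haveI := hint
  -- the normalization is finite (E. Noether), hence proper
  haveI : IsFinite (normalizationι X) :=
    isFinite_normalizationι X NoetherFiniteIntegralClosure_holds f
  -- `X^ν` is locally of finite type over `k`, hence locally Noetherian (Noetherian stalks)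
  haveI : IsLocallyNoetherian (normalization X) :=
    LocallyOfFiniteType.isLocallyNoetherian (normalizationι X ≫ f)
  refine ⟨normalization X, normalizationι X, inferInstance, isBirational_normalizationι X f,
    inferInstance, topologicalKrullDim_normalization X f, fun x => ⟨?_, inferInstance, ?_⟩⟩
  · exact isIntegrallyClosed_stalk_normalization X x
  · rw [← topologicalKrullDim_normalization X f]
    exact ringKrullDim_stalk_le_topologicalKrullDim (normalization X) x

end Summit.ResolutionOfSingularities.ResolutionOfSingularities.Theorems.FInjectiveMacaulayfication.NormalizationModel

end
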